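import Mathlib
import Summits.Ventures.HodgeRepro2.Tier7.Line3.KappaNatural
import Summits.Ventures.HodgeRepro2.T7SupportTwoTorusMatrix

/-!
# Tier 7 — LINE 3 support: a local equality of the two-torus invariant forces the global double coset
(`Line3/KappaIsolation.lean`; t7-L1-p5, gen 2; continues `Line3/KappaNatural.lean`)

L3-ARGUMENT §2a, last paragraph: «the isolation of §2 needs only ONE finite place of small support (`v₁`):
`κ(γ) = κ(γ₀)` in `F_{v₁}` already forces `γ ∈ T_A(F) γ₀ T_B(F)`». In the kernel: for a ring homomorphism
`ψ : E →+* E′` intertwining the involutions (the completion `E → E_{v₁}`; injective, as every ring homomorphism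
between fields), `kappa_map` identifies `ψ (κ(γ))` with the local invariant, so
* `kappa_eq_of_map_eq`: `ψ (κ(γ′)) = ψ (κ(γ)) → κ(γ′) = κ(γ)`;
* `map_kappa_ne_zero_iff` / `map_kappa_ne_one_iff`: regularity (`κ ∉ {0, 1}`) is read locally;
* `exists_double_coset_of_map_kappa_eq` / `exists_double_coset_matrix_of_map_kappa_eq`: under p1's hypotheses
  (`T7SupportTwoTorusInvariant.exists_double_coset_of_kappa_eq`, `T7SupportTwoTorusMatrix.exists_double_coset_matrix_of_kappa_eq`)
  and the LOCAL equality `ψ (κ(γ′)) = ψ (κ(γ))` with `ψ (κ(γ)) ∉ {0, 1}`: there are `a, b` of norm one and `t′ ∈ T_B`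
  with `γ′ = diagonal a · γ · t′` over the GLOBAL field `E` — one double coset per regular local value of κ.

What stays in words: that the local invariant of the real `γ` at `v₁` is `ψ (κ(γ))` for the global adapted pair
(t7-crit-2 l. 15198 record (2)) and the identification of `supp f_{v₁}` with a κ-class (x1's `KappaCongruence`).
Nothing about the real group, periods or (N). Pure algebra.
Sorry-free; axioms: propext / Classical.choice / Quot.sound. §8(d): uses an L-value-free non-vanishing device: NO.
-/

namespace Summit.Ventures.HodgeRepro2.Tier7.Line3.KappaIsolation

open Matrix Summit.Ventures.HodgeRepro2.T7SupportTwoTorusInvariant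
  Summit.Ventures.HodgeRepro2.Tier7.Line3.KappaNatural

variable {E E' : Type*} [Field E] [Field E'] (σ : E →+* E) (σ' : E' →+* E') (ψ : E →+* E')
  (d : Fin 2 → E) (f : Fin 2 → Fin 2 → E)

/-- a local equality of the invariants is a global one (`ψ` is injective) -/
theorem kappa_eq_of_map_eq {γ γ' : Matrix (Fin 2) (Fin 2) E}
    (h : ψ (kappa σ d f γ') = ψ (kappa σ d f γ)) : kappa σ d f γ' = kappa σ d f γ :=
  ψ.injective h

/-- `κ(γ) ≠ 0` is read locally -/
theorem map_kappa_ne_zero_iff (γ : Matrix (Fin 2) (Fin 2) E) :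
    ψ (kappa σ d f γ) ≠ 0 ↔ kappa σ d f γ ≠ 0 := by
  rw [Ne, Ne, map_eq_zero]

/-- `κ(γ) ≠ 1` is read locally -/
theorem map_kappa_ne_one_iff (γ : Matrix (Fin 2) (Fin 2) E) :
    ψ (kappa σ d f γ) ≠ 1 ↔ kappa σ d f γ ≠ 1 := by
  rw [Ne, Ne, ← map_one ψ]
  exact not_congr ψ.injective.eq_iff

/-- **the isolation step**: a local equality of the invariants at a regular value forces `γ′ ∈ T_A γ T_B` over the
global field (vector form, p1's `exists_double_coset_of_kappa_eq`) -/
theorem exists_double_coset_of_map_kappa_eq (hσ : ∀ x, σ (σ x) = x) (hd : ∀ i, σ (d i) = d i)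
    (hd0 : ∀ i, d i ≠ 0) (horth : herm σ d (f 0) (f 1) = 0) (hf0 : disc' σ d f 0 ≠ 0)
    (hf1 : disc' σ d f 1 ≠ 0) {γ γ' : Matrix (Fin 2) (Fin 2) E} (hγ : IsIsom σ d γ) (hγ' : IsIsom σ d γ')
    (hloc : ψ (kappa σ d f γ') = ψ (kappa σ d f γ)) (h0 : ψ (kappa σ d f γ) ≠ 0)
    (h1 : ψ (kappa σ d f γ) ≠ 1) :
    ∃ a b : Fin 2 → E, (∀ i, nrm σ (a i) = 1) ∧ (∀ j, nrm σ (b j) = 1) ∧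
      ∀ j, γ' *ᵥ f j = (diagonal a * γ) *ᵥ (b j • f j) :=
  exists_double_coset_of_kappa_eq σ hσ d hd hd0 f horth hf0 hf1 γ γ' hγ hγ'
    (kappa_eq_of_map_eq σ ψ d f hloc) ((map_kappa_ne_zero_iff σ ψ d f γ).1 h0)
    ((map_kappa_ne_one_iff σ ψ d f γ).1 h1)

/-- **the isolation step, matrix form**: `γ′ = diagonal a · γ · t′` with `t′ ∈ T_B` over the global field
(p1's `exists_double_coset_matrix_of_kappa_eq`) -/
theorem exists_double_coset_matrix_of_map_kappa_eq (hσ : ∀ x, σ (σ x) = x) (hd : ∀ i, σ (d i) = d i)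
    (hd0 : ∀ i, d i ≠ 0) (horth : herm σ d (f 0) (f 1) = 0) (hf0 : disc' σ d f 0 ≠ 0)
    (hf1 : disc' σ d f 1 ≠ 0) {γ γ' : Matrix (Fin 2) (Fin 2) E} (hγ : IsIsom σ d γ) (hγ' : IsIsom σ d γ')
    (hloc : ψ (kappa σ d f γ') = ψ (kappa σ d f γ)) (h0 : ψ (kappa σ d f γ) ≠ 0)
    (h1 : ψ (kappa σ d f γ) ≠ 1) :
    ∃ (a b : Fin 2 → E) (t' : Matrix (Fin 2) (Fin 2) E), (∀ i, nrm σ (a i) = 1) ∧ (∀ j, nrm σ (b j) = 1) ∧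
      ActsOn f t' b ∧ γ' = diagonal a * γ * t' :=
  Summit.Ventures.HodgeRepro2.T7SupportTwoTorusMatrix.exists_double_coset_matrix_of_kappa_eq σ hσ d hd hd0 f
    (Summit.Ventures.HodgeRepro2.T7SupportTwoTorusMatrix.isUnit_det_of_orth σ hσ d f horth hf0 hf1) horth hf0 hf1
    γ γ' hγ hγ' (kappa_eq_of_map_eq σ ψ d f hloc) ((map_kappa_ne_zero_iff σ ψ d f γ).1 h0)
    ((map_kappa_ne_one_iff σ ψ d f γ).1 h1)

/-- the local equality in the LOCAL invariant's own terms: `kappa σ′ (ψ ∘ d) (ψ ∘∘ f) (γ′.map ψ) = kappa σ′ … (γ.map ψ)`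
(the invariant computed in the completion) is the hypothesis `hloc` above (`kappa_map`) -/
theorem map_kappa_eq_iff (hψ : ∀ x, ψ (σ x) = σ' (ψ x)) (γ γ' : Matrix (Fin 2) (Fin 2) E) :
    kappa σ' (fun i => ψ (d i)) (fun j i => ψ (f j i)) (γ'.map ψ) =
        kappa σ' (fun i => ψ (d i)) (fun j i => ψ (f j i)) (γ.map ψ) ↔
      kappa σ d f γ' = kappa σ d f γ := by
  rw [← kappa_map σ σ' ψ hψ d f γ', ← kappa_map σ σ' ψ hψ d f γ]
  exact ψ.injective.eq_iff

end Summit.Ventures.HodgeRepro2.Tier7.Line3.KappaIsolation
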